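import Summits.HodgeConjecture.HodgeConjecture.Theorems.Ring2WeilCoverageCMFieldAllPrimesD
import Summits.HodgeConjecture.HodgeConjecture.Theorems.Ring2WeilCoverageCMFieldAllPrimesE
import Summits.HodgeConjecture.HodgeConjecture.Theorems.Ring2WeilCoverageCMFieldDegreeOnePrimesGeneral
import HarnessLib

/-!
# Weil-type components over quartic CM fields, IX (part H): the HALF-SPLIT primes of the non-Galois field
# `ℚ(√-(3+√2))` with `ℓ` variable — a generator `π = x + y√2` from Thue's lemma fed to the general degree-one engine

research route conditional on HC_CM; not a corollary; Q11.4-sentence-2 already refuted in dim ≥ 3. Cell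
`pub-hodge-ring2`, seat `ring2-b03` (gen 51); complement to parts C and E for the `D₄` census field
`E = ℚ(√-(3+√2))`, `F = ℚ(√2)`, `σ = -3-√2`, `Nm σ = 7`, `R = S² + 6S + 7`. A prime `ℓ ≡ ±1 (mod 8)` splits in `F`;
if `(7/ℓ) = -1` the two images `-3 ∓ r` of `σ` (`r² = 2`) have product `7`, a non-square, so EXACTLY ONE place of
`F` over `ℓ` is inert in `E/F` («half-split» primes: `17, 23, 41, 71, …`; in a non-Galois field conjugate places
may behave differently). The gen-50 engine `mk_norm_mul_ne_splitDiscriminantClassCM_of_inert_general` decides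
`[ℓw] ≠ [1]` at such a place from an explicit generator `π = u₀ + v₀σ` with `Nm π = ℓ` and a `γ` with `πγ = t + σ`
(gens 48/50: numerals `17, 23`). Here `π` is produced for a VARIABLE `ℓ`: Thue's lemma (part E) gives
`x² - 2y² = -ℓ` with `x ≡ ry`, the unit `1 + √2` of norm `-1` turns it into `x'² - 2y'² = ℓ`, Bezout gives `γ`
(`gcd(y', x' + 3y') = 1` since its square divides `ℓ`), the multiplicativity of the norm form gives
`t² - 6t + 7 ≡ 0 (mod ℓ)`, and if `-t` happens to be a square the CONJUGATE generator `π̄` (with `γ' = -γ̄`,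
`t' = 6 - t`, `(-t)(-t') ≡ 7`) is inert instead. Result:

* **`[ℓw] ≠ [1]` for every prime `ℓ mod 56 ∈ {15, 17, 23, 33, 39, 41}`** (`ℓ ≡ ±1 (mod 8)`, `(7/ℓ) = -1`), `ℓ ∤ w`;
  with part C (`ℓ ≡ ±3 (mod 8)`, `(7/ℓ) = -1`): `[ℓw] ≠ [1]` for EVERY prime `ℓ ∤ 14` with `(7/ℓ) = -1`; pairwise
  distinctness and infinitude on this family (part D's generic lemmas). Together with gen 48's
  `…_of_nonsq_mod_seven` (`(ℓ/7) = -1`, obstruction at the tame ramified place) the only obstructed primes of this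
  field NOT covered by a variable-`ℓ` theorem are the split-in-`F` primes with `(7/ℓ) = (ℓ/7) = +1` and both places
  inert in `E/F` — not a congruence condition (`E/ℚ` is not abelian).

No named fact, no definition, no `sorry`; nothing about the Hodge conjecture is asserted.
References: [Deligne1982HodgeCycles] §4 p. 30 (1), Cor. 4.2, Lemma 4.6; [Landherr1936HermitianForms]. -/

noncomputable section

set_option linter.dupNamespace false

open Polynomial

namespace Summit.HodgeConjecture.HodgeConjecture.Ring2.WeilCoverageCM

open Literature.AlgebraicGeometry.Deligne1982
open Literature.AlgebraicGeometry.HodgeTheory (splitDiscriminantClassCM)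

/-! ### §1 A generator of a prime of `ℤ[√2]` over `ℓ ≡ ±1 (mod 8)` from Thue's lemma -/

section Generator

variable {ℓ : ℕ} [hℓ : Fact ℓ.Prime]

/-- **`x² - 2y² = ℓ` for every prime `ℓ ≡ ±1 (mod 8)`, with `x ≡ ry (mod ℓ)` for a prescribed square root `r` of
`2`**: Thue gives `x₀ ≡ r y₀`, `x₀², y₀² < ℓ`, so `ℓ ∣ x₀² - 2y₀²` and `-2ℓ < x₀² - 2y₀² < ℓ`, whence `x₀² - 2y₀² = -ℓ`
(`0` is excluded by the irrationality of `√2`); then `x = x₀ + 2y₀`, `y = x₀ + y₀` (multiplication by the unit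
`1 + √2` of norm `-1`). [folklore] -/
theorem exists_sq_sub_two_mul_sq_eq_prime (r : ZMod ℓ) (hr : r ^ 2 = 2) :
    ∃ x y : ℤ, x ^ 2 - 2 * y ^ 2 = ℓ ∧ (x : ZMod ℓ) = r * y := by
  have hℓp : Prime (ℓ : ℤ) := Nat.prime_iff_prime_int.1 hℓ.out
  obtain ⟨x, y, hne, hx, hy, hxy⟩ := thue_lemma r
  have hdvd : (ℓ : ℤ) ∣ x ^ 2 - 2 * y ^ 2 := by
    rw [← ZMod.intCast_zmod_eq_zero_iff_dvd]
    push_cast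
    rw [hxy]
    linear_combination (y : ZMod ℓ) ^ 2 * hr
  obtain ⟨k, hk⟩ := hdvd
  -- `-2 < k < 1`, and `k ≠ 0`
  have hk1 : k < 1 := by
    by_contra h
    rw [not_lt] at h
    nlinarith [sq_nonneg y]
  have hk2 : -2 < k := by
    by_contra h
    rw [not_lt] at h
    have h2 : (0 : ℤ) ≤ 2 * y ^ 2 := by positivity
    nlinarith [sq_nonneg x]
  have hk0 : k ≠ 0 := by
    rintro rfl
    rw [mul_zero] at hk
    rcases eq_or_ne y 0 with rfl | hy0
    · have hx0 : x = 0 := by nlinarith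
      rcases hne with h | h
      · exact h hx0
      · exact h rfl
    · have hq : ((x : ℚ)) ^ 2 = 2 * (y : ℚ) ^ 2 := by exact_mod_cast (sub_eq_zero.1 hk)
      exact rat_sq_ne_prime_mul_sq Nat.prime_two (m := (y : ℚ)) (by exact_mod_cast hy0) (x : ℚ)
        (by rw [hq]; norm_num)
  have hk' : k = -1 := by omega
  rw [hk'] at hk
  refine ⟨x + 2 * y, x + y, by linear_combination -hk, ?_⟩
  push_cast
  rw [hxy]
  linear_combination (-(y : ZMod ℓ)) * hr

end Generator

/-! ### §2 `(7/ℓ) = -1` on the split classes: `ℓ mod 56 ∈ {15, 17, 23, 33, 39, 41}` -/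

/-- `7` is a NON-square mod a prime `ℓ ≡ ±1 (mod 8)` in the classes `ℓ mod 56 ∈ {15, 17, 23, 33, 39, 41}`
(`ℓ ≡ 1 (8)`: `(7/ℓ) = (ℓ/7)`, `ℓ ≡ 3, 5, 6 (7)`; `ℓ ≡ 7 (8)`: `(7/ℓ) = -(ℓ/7)`, `ℓ ≡ 1, 2, 4 (7)`). [folklore] -/
theorem not_isSquare_seven_of_mod_fiftySix' {ℓ : ℕ} [Fact ℓ.Prime]
    (h56 : ℓ % 56 = 15 ∨ ℓ % 56 = 17 ∨ ℓ % 56 = 23 ∨ ℓ % 56 = 33 ∨ ℓ % 56 = 39 ∨ ℓ % 56 = 41) :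
    ¬ IsSquare (7 : ZMod ℓ) := by
  have n3 : ¬ IsSquare ((3 : ℕ) : ZMod 7) := by decide
  have n5 : ¬ IsSquare ((5 : ℕ) : ZMod 7) := by decide
  have n6 : ¬ IsSquare ((6 : ℕ) : ZMod 7) := by decide
  have y1 : IsSquare ((1 : ℕ) : ZMod 7) := by decide
  have y2 : IsSquare ((2 : ℕ) : ZMod 7) := by decide
  have y4 : IsSquare ((4 : ℕ) : ZMod 7) := by decide
  haveI : Fact (Nat.Prime 7) := ⟨by norm_num⟩
  have hℓ7 : ℓ ≠ 7 := by omega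
  intro h
  have h' : IsSquare ((7 : ℕ) : ZMod ℓ) := by exact_mod_cast h
  rcases h56 with h | h | h | h | h | h
  · -- 15: ℓ ≡ 7 (8), ℓ ≡ 1 (7)
    have key := (ZMod.exists_sq_eq_prime_iff_of_mod_four_eq_three (p := ℓ) (q := 7) (by omega) (by norm_num) hℓ7).1 h'
    rw [← ZMod.natCast_mod ℓ 7, show ℓ % 7 = 1 by omega] at key; exact key y1
  · -- 17: ℓ ≡ 1 (8), ℓ ≡ 3 (7)
    have key := (ZMod.exists_sq_eq_prime_iff_of_mod_four_eq_one (p := ℓ) (q := 7) (by omega) (by norm_num)).1 h'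
    rw [← ZMod.natCast_mod ℓ 7, show ℓ % 7 = 3 by omega] at key; exact n3 key
  · -- 23: ℓ ≡ 7 (8), ℓ ≡ 2 (7)
    have key := (ZMod.exists_sq_eq_prime_iff_of_mod_four_eq_three (p := ℓ) (q := 7) (by omega) (by norm_num) hℓ7).1 h'
    rw [← ZMod.natCast_mod ℓ 7, show ℓ % 7 = 2 by omega] at key; exact key y2
  · -- 33: ℓ ≡ 1 (8), ℓ ≡ 5 (7)
    have key := (ZMod.exists_sq_eq_prime_iff_of_mod_four_eq_one (p := ℓ) (q := 7) (by omega) (by norm_num)).1 h'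
    rw [← ZMod.natCast_mod ℓ 7, show ℓ % 7 = 5 by omega] at key; exact n5 key
  · -- 39: ℓ ≡ 7 (8), ℓ ≡ 4 (7)
    have key := (ZMod.exists_sq_eq_prime_iff_of_mod_four_eq_three (p := ℓ) (q := 7) (by omega) (by norm_num) hℓ7).1 h'
    rw [← ZMod.natCast_mod ℓ 7, show ℓ % 7 = 4 by omega] at key; exact key y4
  · -- 41: ℓ ≡ 1 (8), ℓ ≡ 6 (7)
    have key := (ZMod.exists_sq_eq_prime_iff_of_mod_four_eq_one (p := ℓ) (q := 7) (by omega) (by norm_num)).1 h'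
    rw [← ZMod.natCast_mod ℓ 7, show ℓ % 7 = 6 by omega] at key; exact n6 key

/-! ### §3 `E = ℚ(√-(3+√2))`: every half-split prime, `ℓ` variable -/

section SqrtNegThreePlusSqrtTwo

variable {R : Polynomial ℤ} (hR : R = X ^ 2 + C 6 * X + C 7) [Fact (Irreducible (realPolyQ R))]
include hR

/-- **`[ℓw] ≠ [1]` for the non-Galois field `E = ℚ(√-(3+√2))` and EVERY prime `ℓ mod 56 ∈ {15, 17, 23, 33, 39, 41}`
(`ℓ ≡ ±1 (mod 8)`, `(7/ℓ) = -1`: the HALF-SPLIT primes), `ℓ ∤ w`.** `π = x + y√2 = (x - 3y) - yσ` with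
`Nm π = x² - 2y² = ℓ` from Thue; `γ` from Bezout (`πγ = t + σ`); `ℓ ∣ t² - 6t + 7` from the multiplicativity of the
norm form; if `-t` (the image of `σ` at `(π)`) is a non-square, the gen-50 engine at `π`; otherwise at the conjugate
`π̄ = (x + 3y) + yσ` with `γ' = -γ̄`, `t' = 6 - t`, where `(-t)(-t') ≡ 7` is a non-square. Census rows `[17]`, `[23]`
(`[34]`; gens 48/50 by numerals) and `41, 71, 79, 89, 97, …` at once. [cite: Deligne1982HodgeCycles, §4 p. 30 (1) and Cor. 4.2]
[cite: Landherr1936HermitianForms] -/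
theorem sqrtNegThreePlusSqrtTwo_mk_prime_mul_ne_splitDiscriminantClassCM_of_halfSplit (ℓ : ℕ) (hℓ : ℓ.Prime)
    (h56 : ℓ % 56 = 15 ∨ ℓ % 56 = 17 ∨ ℓ % 56 = 23 ∨ ℓ % 56 = 33 ∨ ℓ % 56 = 39 ∨ ℓ % 56 = 41)
    (w : ℤ) (hw : ¬ (ℓ : ℤ) ∣ w) (u : (realField R)ˣ)
    (hu : (u : realField R) = AdjoinRoot.of (realPolyQ R) (ℓ * w)) :
    (QuotientGroup.mk u : cmNormResidueGroup R) ≠ splitDiscriminantClassCM R 2 := by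
  haveI : Fact ℓ.Prime := ⟨hℓ⟩
  have hℓp : Prime (ℓ : ℤ) := Nat.prime_iff_prime_int.1 hℓ
  have hℓ0 : (ℓ : ℤ) ≠ 0 := by exact_mod_cast hℓ.ne_zero
  have h2 : ℓ ≠ 2 := by omega
  have h2' : (2 : ZMod ℓ) ≠ 0 := by exact_mod_cast natCast_prime_ne_zero_zmod Nat.prime_two h2
  have hns7 : ¬ IsSquare (7 : ZMod ℓ) := not_isSquare_seven_of_mod_fiftySix' h56
  obtain ⟨r, hr⟩ := (ZMod.exists_sq_eq_two_iff h2).2 (by omega)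
  obtain ⟨x, y, hxy, -⟩ := exists_sq_sub_two_mul_sq_eq_prime (ℓ := ℓ) r (by rw [sq, ← hr])
  -- `ℓ ∤ y`, and `gcd(y, x) = 1`
  have hy : ¬ (ℓ : ℤ) ∣ y := by
    rintro ⟨b, hb⟩
    have hx : (ℓ : ℤ) ∣ x ^ 2 := by
      refine ⟨1 + 2 * ℓ * b ^ 2, ?_⟩
      rw [hb] at hxy
      linear_combination hxy
    obtain ⟨a, ha⟩ := hℓp.dvd_of_dvd_pow hx
    have e : (ℓ : ℤ) * (ℓ * (a ^ 2 - 2 * b ^ 2) - 1) = 0 := by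
      rw [ha, hb] at hxy
      linear_combination hxy
    have e' : (ℓ : ℤ) * (a ^ 2 - 2 * b ^ 2) - 1 = 0 := (mul_eq_zero.1 e).resolve_left hℓ0
    have h1 : (ℓ : ℤ) ∣ 1 := by
      refine ⟨a ^ 2 - 2 * b ^ 2, ?_⟩
      linear_combination -e'
    exact hℓ.not_dvd_one (by exact_mod_cast h1)
  have hcop : IsCoprime y x := by
    rw [Int.isCoprime_iff_gcd_eq_one]
    obtain ⟨g, hg⟩ : ∃ g : ℤ, g = ((Int.gcd y x : ℕ) : ℤ) := ⟨_, rfl⟩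
    have hd1 : g ∣ y := by rw [hg]; exact Int.gcd_dvd_left y x
    have hd2 : g ∣ x := by rw [hg]; exact Int.gcd_dvd_right y x
    have hdl : g ∣ (ℓ : ℤ) := by
      obtain ⟨c, hc⟩ := hd1
      obtain ⟨d, hd⟩ := hd2
      refine ⟨g * (d ^ 2 - 2 * c ^ 2), ?_⟩
      rw [← hxy, hc, hd]; ring
    rw [hg] at hdl hd1
    have hdl' : Int.gcd y x ∣ ℓ := by exact_mod_cast hdl
    rcases (Nat.dvd_prime hℓ).1 hdl' with h | h
    · exact h
    · exfalso; rw [h] at hd1; exact hy hd1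
  have hcop' : IsCoprime (-y) (x + 3 * y) := by
    have h1 := (hcop.neg_left).add_mul_right_right (-3)
    have e : x + -3 * -y = x + 3 * y := by ring
    rwa [e] at h1
  obtain ⟨g₀, g₁, hbez⟩ := hcop'
  -- `π = u₀ + v₀σ` with `u₀ = x - 3y`, `v₀ = -y`; `γ = g₀ + g₁σ`; `t`
  obtain ⟨u₀, hu₀⟩ : ∃ u₀ : ℤ, u₀ = x - 3 * y := ⟨_, rfl⟩
  obtain ⟨v₀, hv₀⟩ : ∃ v₀ : ℤ, v₀ = -y := ⟨_, rfl⟩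
  obtain ⟨t, ht⟩ : ∃ t : ℤ, u₀ * g₀ - 7 * v₀ * g₁ = t := ⟨_, rfl⟩
  have hnorm : u₀ ^ 2 - 6 * u₀ * v₀ + 7 * v₀ ^ 2 = (ℓ : ℤ) := by rw [hu₀, hv₀]; linear_combination hxy
  have hnorm' : (u₀ - 6 * v₀) ^ 2 - 6 * (u₀ - 6 * v₀) * (-v₀) + 7 * (-v₀) ^ 2 = (ℓ : ℤ) := by
    linear_combination hnorm
  have hγ : v₀ * g₀ + u₀ * g₁ - 6 * v₀ * g₁ = 1 := by rw [hu₀, hv₀]; linear_combination hbez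
  have hL : (u₀ ^ 2 - 6 * u₀ * v₀ + 7 * v₀ ^ 2).natAbs = ℓ := by rw [hnorm]; exact Int.natAbs_natCast ℓ
  have hL' : ((u₀ - 6 * v₀) ^ 2 - 6 * (u₀ - 6 * v₀) * (-v₀) + 7 * (-v₀) ^ 2).natAbs = ℓ := by
    rw [hnorm']; exact Int.natAbs_natCast ℓ
  have hv : ¬ (ℓ : ℤ) ∣ v₀ := by rw [hv₀]; exact fun h => hy (dvd_neg.1 h)
  -- `t² - 6t + 7 ≡ 0 (mod ℓ)`: the norm form is multiplicative, `Nm(π)·Nm(γ) = Nm(t + σ)`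
  have hroot : ((t : ZMod ℓ)) ^ 2 - 6 * t + 7 = 0 := by
    have e : (u₀ ^ 2 - 6 * u₀ * v₀ + 7 * v₀ ^ 2) * (g₀ ^ 2 - 6 * g₀ * g₁ + 7 * g₁ ^ 2) = t ^ 2 - 6 * t + 7 := by
      rw [← ht]
      linear_combination (-6 * (u₀ * g₀ - 7 * v₀ * g₁) + 7 * ((v₀ * g₀ + u₀ * g₁ - 6 * v₀ * g₁) + 1)) * hγ
    rw [hnorm] at e
    have := congrArg (Int.cast : ℤ → ZMod ℓ) e
    push_cast at this
    rw [ZMod.natCast_self, zero_mul] at this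
    linear_combination -this
  have h2t : ¬ (ℓ : ℤ) ∣ 2 * t - 6 := by
    rw [← ZMod.intCast_zmod_eq_zero_iff_dvd]
    push_cast
    intro h
    have ht3 : (t : ZMod ℓ) = 3 := by
      have : (2 : ZMod ℓ) * ((t : ZMod ℓ) - 3) = 0 := by linear_combination h
      exact sub_eq_zero.1 ((mul_eq_zero.1 this).resolve_left h2')
    rw [ht3] at hroot
    exact h2' (by linear_combination -hroot)
  have h2t' : ¬ (ℓ : ℤ) ∣ 2 * (6 - t) - 6 := by
    intro h
    apply h2t
    have e : 2 * t - 6 = -(2 * (6 - t) - 6) := by ring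
    rw [e]
    exact dvd_neg.2 h
  by_cases hsq : IsSquare (-(t : ZMod ℓ))
  · -- `-t` a square: use the conjugate generator `π̄ = (u₀ - 6v₀) + (-v₀)σ`, `γ' = (6g₁ - g₀) + g₁σ`, `t' = 6 - t`
    obtain ⟨c, hc⟩ := hsq
    have hns' : ∀ s : ZMod ℓ, s ^ 2 ≠ -((6 - t : ℤ) : ZMod ℓ) := by
      intro s hs
      push_cast at hs
      exact hns7 ⟨s * c, by linear_combination (-(c * c)) * hs + ((t : ZMod ℓ) - 6) * hc + hroot⟩
    exact mk_norm_mul_ne_splitDiscriminantClassCM_of_inert_general hR (by norm_num) (by norm_num)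
      disc_not_sq_six_seven (u₀ - 6 * v₀) (-v₀) (6 * g₁ - g₀) g₁ (6 - t) ℓ hℓ hL'
      (by rw [← ht]; linear_combination 6 * hγ) (by linear_combination hγ) hns' h2t' (fun h => hv (dvd_neg.1 h)) w hw u
      (by rw [hu, hnorm']; push_cast; ring)
  · exact mk_norm_mul_ne_splitDiscriminantClassCM_of_inert_general hR (by norm_num) (by norm_num)
      disc_not_sq_six_seven u₀ v₀ g₀ g₁ t ℓ hℓ hL ht hγ (forall_sq_ne_of_not_isSquare hsq) h2t hv w hw u
      (by rw [hu, hnorm]; push_cast; ring)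

/-- **`[ℓ] ≠ [1]` for `E = ℚ(√-(3+√2))` and every prime `ℓ mod 56 ∈ {15, 17, 23, 33, 39, 41}`** (the half-split
primes). [cite: Deligne1982HodgeCycles, §4 p. 30 (1) and Cor. 4.2] -/
theorem sqrtNegThreePlusSqrtTwo_mk_prime_ne_splitDiscriminantClassCM_of_halfSplit (ℓ : ℕ) (hℓ : ℓ.Prime)
    (h56 : ℓ % 56 = 15 ∨ ℓ % 56 = 17 ∨ ℓ % 56 = 23 ∨ ℓ % 56 = 33 ∨ ℓ % 56 = 39 ∨ ℓ % 56 = 41)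
    (u : (realField R)ˣ) (hu : (u : realField R) = ℓ) :
    (QuotientGroup.mk u : cmNormResidueGroup R) ≠ splitDiscriminantClassCM R 2 :=
  sqrtNegThreePlusSqrtTwo_mk_prime_mul_ne_splitDiscriminantClassCM_of_halfSplit hR ℓ hℓ h56 1
    (by exact_mod_cast hℓ.not_dvd_one) u
    (by rw [hu, Int.cast_one, mul_one]; exact (map_natCast (AdjoinRoot.of (realPolyQ R)) ℓ).symm)

/-- **The half-split family: infinitely many pairwise distinct NON-SPLIT components `W8.E.[ℓ]` for
`E = ℚ(√-(3+√2))`, `ℓ mod 56 ∈ {15, 17, 23, 33, 39, 41}` prime** (Dirichlet; part D's generic lemmas).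
[cite: Deligne1982HodgeCycles, §4 p. 30 (1) and Cor. 4.2] [cite: Landherr1936HermitianForms] -/
theorem sqrtNegThreePlusSqrtTwo_infinite_nonsplit_halfSplit :
    Set.Infinite {δ : cmNormResidueGroup R | δ ≠ splitDiscriminantClassCM R 2 ∧
      ∃ ℓ ∈ {ℓ : ℕ | ℓ.Prime ∧
        (ℓ % 56 = 15 ∨ ℓ % 56 = 17 ∨ ℓ % 56 = 23 ∨ ℓ % 56 = 33 ∨ ℓ % 56 = 39 ∨ ℓ % 56 = 41)},
        ∃ u : (realField R)ˣ, (u : realField R) = ℓ ∧ QuotientGroup.mk u = δ} := by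
  haveI := fact_irreducible_cmPolyQ_of_pos hR (by norm_num) (by norm_num) disc_not_sq_six_seven
  have hPinf : Set.Infinite {ℓ : ℕ | ℓ.Prime ∧
      (ℓ % 56 = 15 ∨ ℓ % 56 = 17 ∨ ℓ % 56 = 23 ∨ ℓ % 56 = 33 ∨ ℓ % 56 = 39 ∨ ℓ % 56 = 41)} :=
    (infinite_setOf_prime_and_mod_eq (q := 56) (a := 15) (by norm_num) (by norm_num) (by norm_num)).mono
      (by rintro ℓ ⟨hℓ, h⟩; exact ⟨hℓ, Or.inl h⟩)
  exact infinite_prime_classes_of_criterion _ hPinf (fun ℓ h => h.1)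
    (fun ℓ h => sqrtNegThreePlusSqrtTwo_mk_prime_mul_ne_splitDiscriminantClassCM_of_halfSplit hR ℓ h.1 h.2)

end SqrtNegThreePlusSqrtTwo

end Summit.HodgeConjecture.HodgeConjecture.Ring2.WeilCoverageCM

end
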